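import Mathlib
import Summits.MatrixMultiplication.MatrixMultiplication.Theses.FidelityWitnesses
import Summits.MatrixMultiplication.MatrixMultiplication.Theorems.FidelityWitnessesDiagonalPowerDecayStubProductFrame
import Summits.MatrixMultiplication.MatrixMultiplication.Theorems.FidelityWitnessesDiagonalPowerDecayConverseAssembly
import Summits.MatrixMultiplication.MatrixMultiplication.Theorems.FidelityWitnessesFidelityThesisSepMajorantSingleProduct
import Summits.MatrixMultiplication.MatrixMultiplication.Theorems.FidelityWitnessesSevenEighthsLawStubSliceElimination
import Literature.Computability.AlgebraicComplexity.AlderStrassen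
import Literature.LinearAlgebra.Matrix.PosSemidefTrace

/-!
# `DiagonalPowerDecay ⟺ stub_middlePairNegativityDecay`: the open stub of line `frame-negativity-singlet-fraction` is
# EQUIVALENT to the crux

Crux `FidelityWitnesses.DiagonalPowerDecay` (stmt-MatrixMultiplication-14053), lead prover-line-stmt-MatrixMultiplication-14053-0.
`MiddlePairNegativityDecay` is the registered stub `stub_middlePairNegativityDecay` of
`Cruxes/DiagonalPowerDecay/Lines/frame_negativity_singlet_fraction.lean`, verbatim.  This file proves both directions:
crux ⇒ stub is part III (`middlePairNegativityDecay_of_body`); stub ⇒ crux is the line's own lever — exact output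
elimination (`sliceElimination`, general `n`), the singlet identity (`sum_redPT_flip`), singlet fraction ≤ negativity
(`flipTraceBound`: `Re Σ_x (Y−Z)(x, flip x) ≤ tr Y + tr Z` for PSD `Y, Z`), and the landed `stub_productFrame`.
Hence `diagonalPowerDecay_iff_middlePairNegativityDecay` (registered unfolded form `diagonalPowerDecay_iff_stub`): the
negativity relaxation loses nothing at the power scale; the stub is exactly crux-sized (so it implies
`ω(ℂ) ≥ 6/(3−2δ) > 2` with the crux, and cannot be refuted unless the crux is).
-/

noncomputable section

-- the tree's namespace `Summit.MatrixMultiplication.MatrixMultiplication.…` repeats a component by design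
set_option linter.dupNamespace false

namespace Summit.MatrixMultiplication.MatrixMultiplication.Theorems.DiagonalPowerDecay

open Literature.LinearAlgebra.Matrix (norm_sum_conj_mul_sq_le)
open Literature.Probability.RandomMatrix (nsq nsq_nonneg)


section Equivalence

open scoped BigOperators ComplexConjugate ComplexOrder Matrix
open Literature.Computability.AlgebraicComplexity
open Summit.MatrixMultiplication.MatrixMultiplication.Theses.FidelityWitnesses (DiagonalPowerDecay)

/-- **MIDDLE-PAIR NEGATIVITY DECAY** — the open stub of line `frame-negativity-singlet-fraction`, verbatim
(`stub_middlePairNegativityDecay` of `Cruxes/DiagonalPowerDecay/Lines/frame_negativity_singlet_fraction.lean`): for every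
`n²` products `u_l ⊗ v_l` and every orthonormal basis `e` of their span, the partially transposed middle-pair reduction
`(Tr_{κν} P_E)^{Γ_{μ'}}` splits as `Y − Z`, `Y, Z ⪰ 0`, `tr Y + tr Z ≤ C n^{3−2δ}`. -/
def MiddlePairNegativityDecay : Prop :=
  ∃ C δ : ℝ, 0 < δ ∧ ∀ (n d : ℕ) (u v : Fin (n ^ 2) → (Fin n × Fin n) → ℂ)
    (e : Fin d → (Fin n × Fin n) → (Fin n × Fin n) → ℂ), d ≤ n ^ 2 →
    (∀ s t : Fin d, (∑ b, ∑ c, conj (e s b c) * e t b c) = if s = t then 1 else 0) →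
    (∀ s, e s ∈ Submodule.span ℂ (Set.range fun l : Fin (n ^ 2) => fun b c => u l b * v l c)) →
    (∀ l : Fin (n ^ 2), (fun b c => u l b * v l c) ∈ Submodule.span ℂ (Set.range e)) →
    ∃ Y Z : Matrix (Fin n × Fin n) (Fin n × Fin n) ℂ, Y.PosSemidef ∧ Z.PosSemidef ∧
      (Matrix.of fun x y : Fin n × Fin n =>
        ∑ s, ∑ κ : Fin n, ∑ ν : Fin n, e s (κ, x.1) (y.2, ν) * conj (e s (κ, y.1) (x.2, ν))) = Y - Z ∧
      (Y.trace + Z.trace).re ≤ C * (n : ℝ) ^ (3 - 2 * δ)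

/-- **Crux ⇒ stub.** `DiagonalPowerDecay → MiddlePairNegativityDecay` (Stages A–C). -/
theorem middlePairNegativityDecay_of_diagonalPowerDecay (h : DiagonalPowerDecay) : MiddlePairNegativityDecay := by
  obtain ⟨C, δ, hδ, hB⟩ := h
  exact middlePairNegativityDecay_of_body hδ hB

/-! ### Stub ⇒ crux (the line's own lever, as in the skeleton: slice elimination + singlet ≤ negativity) -/

/-- The FLIP `(μ,μ') ↦ (μ',μ)` as a permutation matrix. -/
def flipM (n : ℕ) : Matrix (Fin n × Fin n) (Fin n × Fin n) ℂ :=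
  Matrix.of fun x y => if y = (x.2, x.1) then 1 else 0

/-- Entries of the flip. -/
theorem flipM_apply {n : ℕ} (x y : Fin n × Fin n) : flipM n x y = if y = (x.2, x.1) then 1 else 0 := rfl

/-- Trace against the flip reads off the flipped diagonal. -/
theorem trace_mul_flipM {n : ℕ} (M : Matrix (Fin n × Fin n) (Fin n × Fin n) ℂ) :
    (M * flipM n).trace = ∑ x, M x (x.2, x.1) := by
  unfold Matrix.trace
  refine Finset.sum_congr rfl fun x _ => ?_
  rw [Matrix.diag_apply, Matrix.mul_apply, Finset.sum_eq_single (x.2, x.1)]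
  · simp [flipM_apply]
  · intro y _ hy
    rw [flipM_apply, if_neg, mul_zero]
    intro h
    apply hy
    rw [h]
  · intro h; exact absurd (Finset.mem_univ _) h

/-- The flip is an involution. -/
theorem flipM_mul_flipM {n : ℕ} : flipM n * flipM n = 1 := by
  ext x z
  rw [Matrix.mul_apply, Finset.sum_eq_single (x.2, x.1)]
  · rw [flipM_apply, flipM_apply, if_pos rfl, one_mul, Matrix.one_apply]
    by_cases h : x = z
    · subst h; simp
    · rw [if_neg, if_neg h]
      intro hz; apply h; rw [hz]
  · intro y _ hy
    rw [flipM_apply, if_neg (Ne.symm (fun h => hy h.symm)), zero_mul]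
  · intro h; exact absurd (Finset.mem_univ _) h

/-- The flip is Hermitian. -/
theorem flipM_conjTranspose {n : ℕ} : (flipM n)ᴴ = flipM n := by
  ext x y
  rw [Matrix.conjTranspose_apply, flipM_apply, flipM_apply]
  by_cases h : y = (x.2, x.1)
  · have h' : x = (y.2, y.1) := by rw [h]
    rw [if_pos h, if_pos h', star_one]
  · have h' : ¬ x = (y.2, y.1) := fun h' => h (by rw [h'])
    rw [if_neg h, if_neg h', star_zero]

/-- **Singlet fraction ≤ negativity** as a matrix fact: for PSD `Y, Z`, `Re Σ_x (Y − Z)(x, flip x) ≤ Re (tr Y + tr Z)`. -/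
theorem flipTraceBound {n : ℕ} (Y Z : Matrix (Fin n × Fin n) (Fin n × Fin n) ℂ)
    (hY : Y.PosSemidef) (hZ : Z.PosSemidef) :
    (∑ x : Fin n × Fin n, (Y - Z) x (x.2, x.1)).re ≤ (Y.trace + Z.trace).re := by
  set F := flipM n with hFdef
  have hFF : F * F = 1 := flipM_mul_flipM
  have hFH : Fᴴ = F := flipM_conjTranspose
  have hsq1 : (1 - F)ᴴ * (1 - F) = 1 - F - F + 1 := by
    rw [Matrix.conjTranspose_sub, Matrix.conjTranspose_one, hFH, sub_mul, one_mul, mul_sub, mul_one, hFF]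
    abel
  have hsq2 : (1 + F)ᴴ * (1 + F) = 1 + F + F + 1 := by
    rw [Matrix.conjTranspose_add, Matrix.conjTranspose_one, hFH, add_mul, one_mul, mul_add, mul_one, hFF]
    abel
  have e1 := Literature.LinearAlgebra.Matrix.re_trace_mul_nonneg_of_posSemidef hY
    (Matrix.posSemidef_conjTranspose_mul_self (1 - F))
  have e2 := Literature.LinearAlgebra.Matrix.re_trace_mul_nonneg_of_posSemidef hZ
    (Matrix.posSemidef_conjTranspose_mul_self (1 + F))
  rw [hsq1, Matrix.mul_add, Matrix.mul_sub, Matrix.mul_sub, Matrix.mul_one, Matrix.trace_add,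
    Matrix.trace_sub, Matrix.trace_sub] at e1
  rw [hsq2, Matrix.mul_add, Matrix.mul_add, Matrix.mul_add, Matrix.mul_one, Matrix.trace_add,
    Matrix.trace_add, Matrix.trace_add] at e2
  simp only [Complex.add_re, Complex.sub_re] at e1 e2
  rw [← trace_mul_flipM, Matrix.sub_mul, Matrix.trace_sub, Complex.sub_re, Complex.add_re]
  linarith

/-- The singlet identity: the capture `Σ_s Σ_a |Σ_m e_s (a.1,m) (m,a.2)|²` is the flipped diagonal sum of the
stub's matrix. -/
theorem sum_redPT_flip {n d : ℕ} (e : Fin d → (Fin n × Fin n) → (Fin n × Fin n) → ℂ) :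
    (∑ x : Fin n × Fin n, (Matrix.of fun x y : Fin n × Fin n =>
        ∑ s, ∑ κ : Fin n, ∑ ν : Fin n, e s (κ, x.1) (y.2, ν) * conj (e s (κ, y.1) (x.2, ν))) x (x.2, x.1)) =
      (((∑ s, ∑ a : Fin n × Fin n, ‖∑ m : Fin n, e s (a.1, m) (m, a.2)‖ ^ 2 : ℝ)) : ℂ) := by
  have hsq : ∀ z : ℂ, ((‖z‖ : ℝ) : ℂ) ^ 2 = z * conj z := fun z => by
    rw [Complex.mul_conj, Complex.normSq_eq_norm_sq]; norm_cast
  calc (∑ x : Fin n × Fin n, (Matrix.of fun x y : Fin n × Fin n =>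
        ∑ s, ∑ κ : Fin n, ∑ ν : Fin n, e s (κ, x.1) (y.2, ν) * conj (e s (κ, y.1) (x.2, ν))) x (x.2, x.1))
      = ∑ x : Fin n × Fin n, ∑ s, ∑ a : Fin n × Fin n,
          e s (a.1, x.1) (x.1, a.2) * conj (e s (a.1, x.2) (x.2, a.2)) := by
        refine Finset.sum_congr rfl fun x _ => ?_
        simp only [Matrix.of_apply]
        refine Finset.sum_congr rfl fun s _ => ?_
        exact (Fintype.sum_prod_type' _).symm
    _ = ∑ s, ∑ a : Fin n × Fin n, ∑ x : Fin n × Fin n,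
          e s (a.1, x.1) (x.1, a.2) * conj (e s (a.1, x.2) (x.2, a.2)) := by
        rw [Finset.sum_comm]
        refine Finset.sum_congr rfl fun s _ => ?_
        rw [Finset.sum_comm]
    _ = ∑ s, ∑ a : Fin n × Fin n, (∑ m : Fin n, e s (a.1, m) (m, a.2)) * conj (∑ m : Fin n, e s (a.1, m) (m, a.2)) := by
        refine Finset.sum_congr rfl fun s _ => Finset.sum_congr rfl fun a _ => ?_
        rw [map_sum, Finset.sum_mul_sum]
        exact Fintype.sum_prod_type' fun m m' : Fin n => e s (a.1, m) (m, a.2) * conj (e s (a.1, m') (m', a.2))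
    _ = _ := by
        simp only [Complex.ofReal_sum, Complex.ofReal_pow, hsq]

/-- **Slice elimination (general `n`).** For an orthonormal frame `e` and a tensor `S` whose output slices lie in
`span e`: `|⟨S,⟨n,n,n⟩⟩|² ≤ ‖S‖² · Σ_s Σ_a |Σ_m e_s (a.1,m) (m,a.2)|²`. -/
theorem sliceElimination {n k : ℕ} (e : Fin k → (Fin n × Fin n) → (Fin n × Fin n) → ℂ)
    (he : ∀ s t : Fin k, (∑ b, ∑ c, conj (e s b c) * e t b c) = if s = t then 1 else 0)
    (S : (Fin n × Fin n) → (Fin n × Fin n) → (Fin n × Fin n) → ℂ)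
    (hS : ∀ a : Fin n × Fin n, S a ∈ Submodule.span ℂ (Set.range e)) :
    ‖∑ a, ∑ b, ∑ c, S a b c * matMulTensor ℂ n n n a b c‖ ^ 2
      ≤ (∑ a, ∑ b, ∑ c, ‖S a b c‖ ^ 2) *
        ∑ s, ∑ a : Fin n × Fin n, ‖∑ m : Fin n, e s (a.1, m) (m, a.2)‖ ^ 2 := by
  classical
  have hd : ∀ a : Fin n × Fin n, ∃ d : Fin k → ℂ, ∑ s, d s • e s = S a := fun a =>
    (Submodule.mem_span_range_iff_exists_fun ℂ).mp (hS a)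
  choose d hd using hd
  have hexp : ∀ a b c, S a b c = ∑ s, d a s * e s b c := by
    intro a b c
    have h := congrFun (congrFun (hd a) b) c
    simpa [Finset.sum_apply, Pi.smul_apply, smul_eq_mul] using h.symm
  have hL : ∑ a, ∑ b, ∑ c, S a b c * matMulTensor ℂ n n n a b c
      = ∑ a, ∑ s, d a s * ∑ m : Fin n, e s (a.1, m) (m, a.2) := by
    refine Finset.sum_congr rfl fun a _ => ?_
    rw [sepMajorant_slice_sum_matMulTensor (S a) a]
    calc ∑ m : Fin n, S a (a.1, m) (m, a.2) = ∑ m : Fin n, ∑ s, d a s * e s (a.1, m) (m, a.2) :=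
          Finset.sum_congr rfl fun m _ => hexp a _ _
      _ = ∑ s, ∑ m : Fin n, d a s * e s (a.1, m) (m, a.2) := Finset.sum_comm
      _ = ∑ s, d a s * ∑ m : Fin n, e s (a.1, m) (m, a.2) :=
          Finset.sum_congr rfl fun s _ => by rw [Finset.mul_sum]
  have hR : ∑ a, ∑ b, ∑ c, ‖S a b c‖ ^ 2 = ∑ a, ∑ s, ‖d a s‖ ^ 2 :=
    Finset.sum_congr rfl fun a _ => parseval_slice' e he (d a) (S a) (hexp a)
  rw [hL, hR, Finset.sum_comm (f := fun s (a : Fin n × Fin n) => ‖∑ m : Fin n, e s (a.1, m) (m, a.2)‖ ^ 2)]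
  exact SevenEighthsLaw.norm_sum_sum_mul_sq_le d fun a s => ∑ m : Fin n, e s (a.1, m) (m, a.2)

/-- The output slices of a sum of triads lie in the span of any frame containing the products. -/
theorem slice_mem_span {n r d : ℕ} (e : Fin d → (Fin n × Fin n) → (Fin n × Fin n) → ℂ)
    (w u v : Fin r → (Fin n × Fin n) → ℂ)
    (hprod : ∀ l : Fin r, (fun b c => u l b * v l c) ∈ Submodule.span ℂ (Set.range e)) (a : Fin n × Fin n) :
    (∑ i, triad (w i) (u i) (v i)) a ∈ Submodule.span ℂ (Set.range e) := by
  have hslice : (∑ i, triad (w i) (u i) (v i)) a = ∑ i, w i a • (fun b c => u i b * v i c) := by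
    funext b c
    simp [Finset.sum_apply, triad_apply, Pi.smul_apply, smul_eq_mul, mul_assoc]
  rw [hslice]
  exact Submodule.sum_mem _ fun i _ => Submodule.smul_mem _ _ (hprod i)

/-- **Stub ⇒ crux** (the composition of the skeleton, with the stub as a hypothesis and the landed
`stub_productFrame`). -/
theorem diagonalPowerDecay_of_middlePairNegativityDecay (h : MiddlePairNegativityDecay) : DiagonalPowerDecay := by
  obtain ⟨C, δ, hδ, hneg⟩ := h
  refine ⟨C, δ, hδ, fun n S hS => ?_⟩
  obtain ⟨w, u, v, hdec⟩ := exists_eq_sum_triad_of_tensorRank_le hS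
  obtain ⟨d, e, hd, he, hps, hprod⟩ := stub_productFrame u v
  obtain ⟨Y, Z, hY, hZ, hsplit, htr⟩ := hneg n d u v e hd he hps hprod
  -- singlet fraction ≤ negativity
  have hcap : (∑ s, ∑ a : Fin n × Fin n, ‖∑ m : Fin n, e s (a.1, m) (m, a.2)‖ ^ 2) ≤ (Y.trace + Z.trace).re := by
    have hre : (∑ s, ∑ a : Fin n × Fin n, ‖∑ m : Fin n, e s (a.1, m) (m, a.2)‖ ^ 2) =
        (∑ x : Fin n × Fin n, (Y - Z) x (x.2, x.1)).re := by
      rw [← hsplit, sum_redPT_flip, Complex.ofReal_re]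
    rw [hre]
    exact flipTraceBound Y Z hY hZ
  have hslices : ∀ a : Fin n × Fin n, S a ∈ Submodule.span ℂ (Set.range e) := by
    intro a; rw [hdec]; exact slice_mem_span e w u v hprod a
  have h1 := sliceElimination e he S hslices
  have hnn : (0 : ℝ) ≤ ∑ a, ∑ b, ∑ c, ‖S a b c‖ ^ 2 := by positivity
  calc ‖∑ a, ∑ b, ∑ c, S a b c * matMulTensor ℂ n n n a b c‖ ^ 2
      ≤ (∑ a, ∑ b, ∑ c, ‖S a b c‖ ^ 2) * ∑ s, ∑ a : Fin n × Fin n, ‖∑ m : Fin n, e s (a.1, m) (m, a.2)‖ ^ 2 := h1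
    _ ≤ (∑ a, ∑ b, ∑ c, ‖S a b c‖ ^ 2) * (C * (n : ℝ) ^ (3 - 2 * δ)) :=
        mul_le_mul_of_nonneg_left (hcap.trans htr) hnn
    _ = C * (n : ℝ) ^ (3 - 2 * δ) * ∑ a, ∑ b, ∑ c, ‖S a b c‖ ^ 2 := by ring

/-- **The PPT law** (the `δ = 1/2` law on an OPEN set of frames): if the stub's matrix — the partially transposed
middle-pair reduction of the frame — is itself positive semidefinite (PPT middle pair; numerically every generic product
frame, kit j014152), then the capture is at most its trace (`= dim E ≤ n²` for an orthonormal frame). -/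
theorem capture_le_trace_of_ppt {n d : ℕ} (e : Fin d → (Fin n × Fin n) → (Fin n × Fin n) → ℂ)
    (hppt : (Matrix.of fun x y : Fin n × Fin n =>
      ∑ s, ∑ κ : Fin n, ∑ ν : Fin n, e s (κ, x.1) (y.2, ν) * conj (e s (κ, y.1) (x.2, ν))).PosSemidef) :
    (∑ s, ∑ a : Fin n × Fin n, ‖∑ m : Fin n, e s (a.1, m) (m, a.2)‖ ^ 2) ≤
      (Matrix.of fun x y : Fin n × Fin n =>
        ∑ s, ∑ κ : Fin n, ∑ ν : Fin n, e s (κ, x.1) (y.2, ν) * conj (e s (κ, y.1) (x.2, ν))).trace.re := by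
  have h := flipTraceBound _ 0 hppt Matrix.PosSemidef.zero
  rw [sub_zero, sum_redPT_flip, Complex.ofReal_re, Matrix.trace_zero, add_zero] at h
  exact h

/-- **EQUIVALENCE.** The open stub of line `frame-negativity-singlet-fraction` is equivalent to the crux
`DiagonalPowerDecay`: the negativity relaxation of the capture loses nothing at the power scale. In particular the
stub is exactly as strong as the crux (hence implies `ω(ℂ) ≥ 6/(3−2δ) > 2`, `Cruxes/DiagonalPowerDecay/Disproof.lean`
`omega_ge_of_body`), and it cannot be refuted by a product family that is "entangled in negativity but decorrelated
from the singlet" unless the crux itself falls. -/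
theorem diagonalPowerDecay_iff_middlePairNegativityDecay : DiagonalPowerDecay ↔ MiddlePairNegativityDecay :=
  ⟨middlePairNegativityDecay_of_diagonalPowerDecay, diagonalPowerDecay_of_middlePairNegativityDecay⟩

/-- **The equivalence, unfolded statement (registered sub-goal `diagonalPowerDecay_iff_stub`).**
`DiagonalPowerDecay ↔ stub_middlePairNegativityDecay` (the stub written out verbatim). -/
theorem diagonalPowerDecay_iff_stub :
    DiagonalPowerDecay ↔
    ∃ C δ : ℝ, 0 < δ ∧ ∀ (n d : ℕ) (u v : Fin (n ^ 2) → (Fin n × Fin n) → ℂ)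
      (e : Fin d → (Fin n × Fin n) → (Fin n × Fin n) → ℂ), d ≤ n ^ 2 →
      (∀ s t : Fin d, (∑ b, ∑ c, conj (e s b c) * e t b c) = if s = t then 1 else 0) →
      (∀ s, e s ∈ Submodule.span ℂ (Set.range fun l : Fin (n ^ 2) => fun b c => u l b * v l c)) →
      (∀ l : Fin (n ^ 2), (fun b c => u l b * v l c) ∈ Submodule.span ℂ (Set.range e)) →
      ∃ Y Z : Matrix (Fin n × Fin n) (Fin n × Fin n) ℂ, Y.PosSemidef ∧ Z.PosSemidef ∧
        (Matrix.of fun x y : Fin n × Fin n =>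
          ∑ s, ∑ κ : Fin n, ∑ ν : Fin n, e s (κ, x.1) (y.2, ν) * conj (e s (κ, y.1) (x.2, ν))) = Y - Z ∧
        (Y.trace + Z.trace).re ≤ C * (n : ℝ) ^ (3 - 2 * δ) :=
  diagonalPowerDecay_iff_middlePairNegativityDecay

end Equivalence
end Summit.MatrixMultiplication.MatrixMultiplication.Theorems.DiagonalPowerDecay

end
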